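import Mathlib
import HarnessLib.Audit.Tags

/-!
# Venture ResidMod — LAW `L10` (twisted-3-torsion family law) of the census cell `pub-residmod`, TYPED per STANDING RULE (5),
# with the lemma-candidate `LEM1` registered in PREDICTIONS-17

HONEST FRAMING. This file STATES, as Lean `Prop`s, a regularity of the cell's genus-2 census («law L10» of
`HOME/STRUCTURE.md` v0.17.1, sha256 `bf43fe14…`; HOME = `run/shared/lean/pub/pub-residmod/`) together with its evidence
ledger. NOTHING is proved here about Galois images, no curve is certified here, and no claim on modularity or on any
summit is made. «LAW» means exactly: each clause HIT in three pre-registered prediction sets on data not used to draft it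
(the cell's typing rule (5), coordinator 2026-08-22); in the direction «member ⇒ not surjective» the mechanism is a
theorem instance per curve (an explicit rational point of order `3` on the Jacobian of a quadratic twist), in the direction
«not surjective ⇒ member» it is a census regularity of SCREEN readings with a heuristic. The decls below are tagged
`@[conjecture]`; they are hypotheses one may assume by name, never facts.

THE OBJECTS. An integer sextic is a coefficient vector `f : Fin 7 → ℤ` (`f i` = coefficient of `xⁱ`), of naive height
`≤ H` when `f 6 ≠ 0 ∧ ∀ i, |f i| ≤ H` (the census box `B_H`, `#B_H = 2H(2H+1)⁶`). The TWISTED-3-TORSION FAMILY `W` is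
ELEMENTARY and typed model-free (`MemberW`): `f ∈ W` iff `m²·4d·f = G² + c·k³` for some squarefree `d ∈ ℤ`, `m ≠ 0`,
`G ∈ ℤ[x]` of degree `≤ 3`, `k ∈ ℤ[x]` nonzero of degree `≤ 2`, `c ≠ 0` — on the twist `C^{(d)} : d·y² = f(x)` the function
`φ = 2dm·y − G(x)` then has norm `c·k³`, so `[div₀ φ /3]` is a `ℚ`-rational point of order `3` on `Jac(C^{(d)})` when
`Disc f ≠ 0` (STRUCTURE §2 C3-EXH, mechanism paragraph). The parametrisation behind it is in print: [DokchitserDoris2019]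
T. Dokchitser, C. Doris, *3-torsion and conductor of genus 2 curves*, Math. Comp. 88 (2019), arXiv:1706.06162, Prop. 4.1
(«non-zero elements of `J[3]` are in 1-1 correspondence with ways of expressing `f = (z₄x³ + z₃x² + z₂x + z₁)² − z₇(x² + z₆x +
z₅)³`, `zᵢ ∈ K̄`, and this correspondence preserves the action of `G_K`»; their [3] = [BruinFlynnTesta2014] N. Bruin, E.V. Flynn,
D. Testa, *Descent via (3,3)-isogeny on Jacobians of genus 2 curves*, Acta Arith. 165 (2014) 201–223, arXiv:1401.0580, proof
of Lemma 3): a `G_ℚ`-stable line `{±Z}` with quadratic character `χ_d` corresponds to a representation with `z₅, z₆, z₇ ∈ ℚ`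
and `(z₁,…,z₄) ∈ √d·ℚ⁴`, i.e. `f = d·G₀² − z₇·k³` with `G₀, k` rational — the twisted identity, after clearing denominators
(the proposition's general position puts the torsion divisor away from infinity, `k` monic quadratic; divisors through the
points at infinity give `deg k ≤ 1`, which `MemberW` allows). The cell ENUMERATED `W` exactly within stated
limits (`|d| ≤ 30`, `m ≤ 3`, ONE free coefficient of `G` bounded — `|g₃| ≤ 120m` for `deg k = 2`, `|g₀| ≤ 120m` for `deg k ≤ 1`,
the other coefficients of `G` being solved from `f` inside the box (erratum: earlier versions wrote `‖G‖∞ ≤ 120m`; the enumerated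
set is the larger one, referee g31) —, `k`-coefficients `≤ 4` / `≤ 6`; PREP-16, `structure/prep16/enum_family_d.py`
sha256 `c61bc728…`), table E20: certificate-typical members of height `≤ H` number `W^typ_H = 0, 56, 296, 1 952, 4 120,
9 112, 14 520, 28 584` for `H = 1…8` (`e20Typ` below); the typed family is limit-free, the enumerated one is a subset.
TYPICALITY is typed model-free as `Gal(f/ℚ) ⊇ A₆` (`Typical`: the Galois group of the splitting field has order `≥ 360`;
it embeds in `S₆`), which is the enumerator's certificate notion AND the census's «Zarhin-typical» notion on the nose: the
only subgroups of `S₆` of index `≤ 2` are `S₆` and `A₆` (referee g31 recount of the `H = 7` box: typical = classes 2.1.1 +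
2.2.1 = 517 900, `NT₇ = 60`; erratum to the first landed version, which wrongly named «the transitive `S₅`» here). The
enumerator's certificate is ONE-SIDED (it can only confirm `≥ A₆`), so `e20Typ` is a LOWER bound for the typed count.
THE MODEL LAYER. «`ρ̄_{J_f,3}` is not surjective» and «`J_f[3]` has a Galois-stable line» are NOT constructed here: they are
the two fields of the abstract structure `GenusTwoMod3Model` (intended reading: `J_f = Jac(y² = f(x))` for `Disc f ≠ 0`,
`ρ̄_{J_f,3} : G_ℚ → GSp₄(𝔽₃)` its mod-3 representation; `NonSurj f` ⇔ the image is a proper subgroup; `StableLine f` ⇔ the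
image stabilises a line of `J_f[3]`, i.e. lies in a Klingen parabolic up to conjugacy — LMFDB classes `3.40.2 ⊃ 3.80.3,
3.80.4, …`), with the one coherence axiom `StableLine f → NonSurj f`. Like every row file of this cell, the statements are
MEANINGFUL ONLY FOR THE INTENDED MODEL. (A tree-level interface — `AbelianVariety ℚ`, `A.geomTorsion 3`, `FramedGaloisRep ℚ
(ZMod 3) 4` as in `Row_709_a_709_1.lean` — would additionally need «`A` is the Jacobian of `y² = f(x)`», which the tree does
not have; the abstract model is the honest placeholder, exactly as `NewformModel` is for venture AbcSig.)

STATEMENT OF L10 (STRUCTURE.md §2, promoted v0.17 by lead g9, R255/R257, from conjecture C3 (count clause) and C3-EXH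
(exhaustion clause) as PREDICTIONS-13 §3 — registered before the `H = 7` box existed — authorised). For random integral
sextics of naive height `≤ H` that are typical, in the boxes the cell sampled (`H = 3, 4, 5, 6` at 50 000 curves each,
`H = 7, 8` at 600 000 each; `16 + 25 + 10 + 7 + 60 + 41 = 159` typical non-surjective curves):
(i) COUNT CLAUSE (`L10_count`) — the number `NT_H` of typical `f` with `ρ̄_{J_f,3}` not surjective is predicted with NO free
parameter from the exact lattice count: `NT_H ≈ λ_T/(1 − ρ)`, `λ_T` = (typical curves sampled) × (`W^typ_H`-density of the
box), remainder rate `ρ ≈ 0.05`, registered allowance `ρ ≤ 0.15` and a `1 %` enumeration tail — `H = 8`: `41` observed vs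
`47.0` predicted (band `[28, 73]`); `H = 7`: `60` vs `59.0` (band `[37, 87]`). Typed at POPULATION level over the whole box:
`W^typ_H(E20) ≤ #NT_H` and `0.85·#NT_H ≤ 1.01·W^typ_H(E20)` for `3 ≤ H ≤ 8`. (The clause's second half — NT curves are
depressed in `|Δ_min|` and conductor by the family's discriminant depression, rung 10 P44 — is not typed: no conductor here.)
(ii) EXHAUSTION CLAUSE — (a) (`L10_klingen_iff_member`) «image in a Klingen parabolic» COINCIDES with membership in `W`:
every Klingen-containing typical reading is a certified member once the identity search is relaxed beyond PREP-16's limits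
(`(d, m)` up to `(2, 3)` at `H = 8`, `(−14, 3)` at `H = 7`) — `152/152` over all boxes, `0` exceptions either way — and every
non-Klingen typical reading carries no quadratic character on any twist; (b) (`L10_exhaustion`) the remainder
`R_H = NT_H ∖ W` has relative size `ρ_H` small and flat in `H`: `3/58` at `H ≤ 6`, `2/41` at `H = 8`, `2/60` at `H = 7`
(it consists exactly of the readings WITHOUT a 1-dimensional constituent: decomposable `3.90.2` ×2 / `3.270.8`, imprimitive
`3.45.1`, `𝔽₉`-semilinear `3.216.1` / `3.72.3`, Siegel `3.40.1` — `7/159`); typed as `#R_H ≤ 0.15·#NT_H` for `3 ≤ H ≤ 8`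
(the registered allowance; PREDICTIONS-11 P51/P53, PREDICTIONS-13 P63/P64).

EVIDENCE LEDGER (pre-registered files under `HOME/structure/`, each sha-stamped on the cell bus BEFORE its data existed;
scorers frozen; every rung re-scored ×2 by an independent referee seat): clause (i) — rung 10 P44 (PREDICTIONS-10
`b0e285f0…`; MEDIUM, tier-flagged, flag discharged by rungs 11/13), rung 11 P53 (a)(b) (PREDICTIONS-11 `61700fe0…`, `H = 8`,
600 000 new curves), rung 13 P63 (a)(b) (PREDICTIONS-13, `H = 7`, a box never sampled before); clause (ii) — rung 10c P50 (a)
`14/14` blind, rung 11 P51 + P56, rung 13 P64 (a)(b)(c). `0` MISS on these items. Drafting inputs and in-sample data are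
disclosed in each registration's §0. What is NOT evidence for L10: LMFDB (a different ordering; used only for C1/E1/E4),
any conductor-ordered statement, anything at `H ≥ 9` (no box sampled; rung 17 = PREDICTIONS-17 `2cb0780c…` extends only
the lattice count `W^typ_H` to `H = 16`, which makes (i) a zero-parameter PREDICTION for future boxes, not a tested law there).
WHY IT MIGHT BE FALSE beyond the sampled boxes (kept from C3-EXH): proper IRREDUCIBLE images (no 1-dimensional constituent)
could have a density decaying slower in `H` than the family's `≍ H⁻³…⁻⁴`, making `ρ_H` grow — hence the height-uniform
form is typed separately as the CONJECTURE `C3EXH_uniform` (0 survivals as such), not as part of the law.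

LEMMA-CANDIDATE `LEM1` (PREDICTIONS-17 §3, wording fixed there before rung 17 ran; a pure lattice-point statement, provable or
refutable without any Galois theory): `W₁₁(H) = #{f : height ≤ H, Disc f ≠ 0, 4f = G² + c·k³, deg G ≤ 3, k primitive of
degree ≤ 2, c ≠ 0}` satisfies `c₁·H³·log H ≤ W₁₁(H) ≤ c₂·H³·log H` for `H ≥ H₀` (heuristic: `G ~ H^{1/2}` per coefficient
gives `H²` choices, `(c, k)` with `|c|·ht(k)³ ≲ H` give `H·Σ_K 1/K ≍ H log H` for `deg k = 2` and `≍ H` for `deg k ≤ 1`).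

References: cell HOME `run/shared/lean/pub/pub-residmod/` (STRUCTURE.md §2 L10/C3/C3-EXH, §4 E20, §7 protocol;
structure/PREDICTIONS-10…17); [DokchitserDoris2019] arXiv:1706.06162 Prop. 4.1; [BruinFlynnTesta2014] arXiv:1401.0580,
doi:10.4064/aa165-3-1; [LMFDB] genus-2 mod-ℓ image labels (3.40.1 Siegel /
3.40.2 Klingen naming as in STRUCTURE §2 L8-cand); Zarhin, *Hyperelliptic Jacobians without complex multiplication*,
Math. Res. Lett. 7 (2000) (typicality ⇒ `End J = ℤ`; not used in any statement below).
-/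

open Polynomial

namespace Summit.Ventures.ResidMod.Conjectures

/-! ## Arithmetic layer (model-free) -/

/-- An integer sextic as a coefficient vector: `f i` is the coefficient of `xⁱ`, `i = 0…6`. -/
abbrev Sextic : Type := Fin 7 → ℤ

/-- The polynomial `∑ f i · xⁱ ∈ ℤ[x]` of a coefficient vector. -/
noncomputable def toPoly (f : Sextic) : ℤ[X] := ∑ i : Fin 7, C (f i) * X ^ (i : ℕ)

/-- The same polynomial over `ℚ`. -/
noncomputable def toRatPoly (f : Sextic) : ℚ[X] := (toPoly f).map (Int.castRingHom ℚ)

/-- The census box `B_H`: leading coefficient nonzero, every coefficient of absolute value `≤ H` (naive height `≤ H`);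
`#B_H = 2H(2H+1)⁶`. -/
def InBox (H : ℕ) (f : Sextic) : Prop := f 6 ≠ 0 ∧ ∀ i, |f i| ≤ (H : ℤ)

/-- `y² = f(x)` is a genus-2 curve: `f` of degree `6` (from `InBox`) with nonzero discriminant, i.e. separable over `ℚ`. -/
def NonDegenerate (f : Sextic) : Prop := f 6 ≠ 0 ∧ (toRatPoly f).Separable

/-- TYPICAL (model-free): the Galois group of `f` over `ℚ` has order `≥ 360`, i.e. (inside `S₆`) it is `A₆` or `S₆` — the
enumerator's certificate notion `Gal(f) ⊇ A₆`; for such `f`, `End(J_f) = ℤ` (Zarhin). -/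
def Typical (f : Sextic) : Prop := 360 ≤ Nat.card (toRatPoly f).Gal

/-- MEMBERSHIP IN THE TWISTED-3-TORSION FAMILY `W` (limit-free, elementary): `m²·4d·f = G² + c·k³` with `d` squarefree,
`m ≠ 0`, `deg G ≤ 3`, `k ≠ 0` of degree `≤ 2`, `c ≠ 0`. Intended meaning for non-degenerate `f`: the Jacobian of the twist
`d·y² = f(x)` has a `ℚ`-rational point of order `3` (the class of `div₀(2dm·y − G(x))/3`). The cell's enumeration (E20) is
the subset `|d| ≤ 30`, `m ∈ {1,2,3}`, free `G`-coefficient `≤ 120m` (see the module docstring), small `k`. -/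
def MemberW (f : Sextic) : Prop :=
  ∃ (d m c : ℤ) (G k : ℤ[X]), Squarefree d ∧ m ≠ 0 ∧ c ≠ 0 ∧ k ≠ 0 ∧ G.natDegree ≤ 3 ∧ k.natDegree ≤ 2 ∧
    C (4 * d * m ^ 2) * toPoly f = G ^ 2 + C c * k ^ 3

/-- The PRINCIPAL CLASS `W₁₁` of PREDICTIONS-17's lemma-candidate: `d = 1`, `m = 1`, `k` primitive (content `1`). -/
def MemberW11 (f : Sextic) : Prop :=
  ∃ (c : ℤ) (G k : ℤ[X]), c ≠ 0 ∧ k ≠ 0 ∧ k.IsPrimitive ∧ G.natDegree ≤ 3 ∧ k.natDegree ≤ 2 ∧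
    C 4 * toPoly f = G ^ 2 + C c * k ^ 3

/-- Table E20 (PREP-16 exact enumeration, `structure/prep16/`, kit j184359/j184447/j184448/j184449; STRUCTURE §4 E20):
certificate-typical members of `W` of naive height `≤ H` within the stated limits, `H = 1…8`; `0` outside that range. -/
def e20Typ : ℕ → ℕ
  | 1 => 0 | 2 => 56 | 3 => 296 | 4 => 1952 | 5 => 4120 | 6 => 9112 | 7 => 14520 | 8 => 28584
  | _ => 0

/-- `W₁₁(H)`: non-degenerate sextics of height `≤ H` in the principal class (a finite set; `Set.ncard`). -/
noncomputable def w11Count (H : ℕ) : ℕ := {f : Sextic | InBox H f ∧ NonDegenerate f ∧ MemberW11 f}.ncard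

/-- Sanity value: the rung-13 identity of STRUCTURE §2 C3-EXH (kit j188107:8602, `(d, m) = (−14, 3)`) for
`F = −3x⁶ − 3x⁴ + 4x³ − 7x² − 7`, in the `m = 3` normalisation `4·(−14)·3²·F = (36x³ − 28)² + 8·(3x² + 7)³` (STRUCTURE prints
the same identity scaled by `4`: `(72x³ − 56)² + 32·(3x² + 7)³ = 4·(−14)·6²·F`), checked coefficient-wise on integer 7-tuples
(both sides `1512x⁶ + 1512x⁴ − 2016x³ + 3528x² + 3528`). -/
example : (fun i : Fin 7 => (4 * (-14) * 3 ^ 2 : ℤ) * (![-7, 0, -7, 4, -3, 0, -3] : Fin 7 → ℤ) i) =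
    ![28 ^ 2 + 8 * 7 ^ 3, 0, 8 * 441, 2 * 36 * (-28), 8 * 189, 0, 36 ^ 2 + 8 * 27] := by
  decide

/-! ## Model layer (abstract; MEANINGFUL ONLY FOR THE INTENDED MODEL) -/

/-- The abstract mod-3 model of genus-2 Jacobians over `ℚ`. Intended reading, for a non-degenerate sextic `f`:
`NonSurj f` ⇔ the image of `ρ̄_{Jac(y²=f(x)),3} : G_ℚ → GSp₄(𝔽₃)` is a proper subgroup; `StableLine f` ⇔ that image
stabilises an `𝔽₃`-line of `J_f[3]` (lies in a Klingen parabolic up to conjugacy; LMFDB `3.40.2` and its subclasses).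
The one axiom records that a line stabiliser is a proper subgroup. Values on degenerate `f` are irrelevant (every clause
below restricts to `NonDegenerate f`). -/
structure GenusTwoMod3Model where
  /-- `ρ̄_{J_f,3}` is not surjective onto `GSp₄(𝔽₃)`. -/
  NonSurj : Sextic → Prop
  /-- `J_f[3]` has a `G_ℚ`-stable line. -/
  StableLine : Sextic → Prop
  /-- coherence: a stable line makes the image proper. -/
  nonSurj_of_stableLine : ∀ f, StableLine f → NonSurj f

variable (M : GenusTwoMod3Model)

/-- `NT_H` (population version of the census count): typical non-degenerate sextics in the box `B_H` whose mod-3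
representation is not surjective. Finite (a subset of the box). -/
def ntSet (H : ℕ) : Set Sextic := {f | InBox H f ∧ NonDegenerate f ∧ Typical f ∧ M.NonSurj f}

/-- The REMAINDER `R_H = NT_H ∖ W`: typical non-surjective sextics of height `≤ H` that are not members of the family. -/
def remSet (H : ℕ) : Set Sextic := {f | f ∈ ntSet M H ∧ ¬ MemberW f}

/-- **LAW L10 (i), COUNT CLAUSE (population form) — NOT A THEOREM.** For every sampled height `3 ≤ H ≤ 8`, the number of
typical non-surjective sextics in the box `B_H` is bracketed by the exact lattice count of table E20 with the registered
allowance (remainder rate `≤ 0.15`, enumeration tail `1 %`): `W^typ_H ≤ #NT_H` and `0.85·#NT_H ≤ 1.01·W^typ_H`.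
Evidence: rungs 10/11/13 (module docstring); census form `NT_H ≈ λ_T/(1 − ρ)` with zero free parameters. FRAMING (referee
g31 power table): at the registered sample sizes the per-`H` form is tested at the 15 % level only at `H = 3` (weakly), `7`
and `8`; `H = 4, 5, 6` ride on the POOLED rate (pooled floor 161.4 vs 159 observed non-surjective typical curves). -/
@[conjecture] def L10_count : Prop :=
  ∀ H : ℕ, 3 ≤ H → H ≤ 8 →
    e20Typ H ≤ (ntSet M H).ncard ∧ (85 : ℚ) * (ntSet M H).ncard ≤ 101 * e20Typ H

/-- **LAW L10 (ii)(a), KLINGEN ⇔ MEMBER — NOT A THEOREM (here).** For non-degenerate sextics, «`J_f[3]` has a Galois-stable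
line» coincides with membership in the twisted-3-torsion family `W`. Direction `←`: the identity exhibits a rational point of
order `3` on the Jacobian of the twist by `d`, a fixed vector of `ρ̄₃ ⊗ χ_d` (theorem instance per curve). Direction `→`:
a stable line has a quadratic character `χ_d` (`𝔽₃ˣ = {±1}`), so `J^{(d)}[3](ℚ) ≠ 0`, and rational `3`-torsion is
parametrised by `f = G² − λk³` ([DokchitserDoris2019, Prop. 4.1], `G_K`-equivariantly; [BruinFlynnTesta2014, proof of
Lemma 3]) — so both directions are EXPECTED to be theorems for the intended model (not formalised by the cell: the model is
abstract here); the census saw `152/152` Klingen-containing typical readings certified as members, `0` exceptions either way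
(rungs 10c/11/12/13). Typed for all non-degenerate `f`; tested on typical ones. -/
@[conjecture] def L10_klingen_iff_member : Prop :=
  ∀ f : Sextic, NonDegenerate f → (M.StableLine f ↔ MemberW f)

/-- **LAW L10 (ii)(b), EXHAUSTION CLAUSE (population form) — NOT A THEOREM.** For every sampled height `3 ≤ H ≤ 8` the
remainder `R_H = NT_H ∖ W` is at most `15 %` of `NT_H` (observed `3/58` at `H ≤ 6`, `2/41` at `H = 8`, `2/60` at `H = 7`;
it consists of the images without a 1-dimensional constituent). -/
@[conjecture] def L10_exhaustion : Prop :=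
  ∀ H : ℕ, 3 ≤ H → H ≤ 8 → (100 : ℚ) * (remSet M H).ncard ≤ 15 * (ntSet M H).ncard

/-- **LAW L10** = the conjunction of its typed clauses. -/
@[conjecture] def L10 : Prop := L10_count M ∧ L10_klingen_iff_member M ∧ L10_exhaustion M

/-- **CONJECTURE C3-EXH, HEIGHT-UNIFORM FORM — 0 survivals as such; NOT part of the law.** The remainder rate stays `≤ 15 %`
at EVERY height `H ≥ 3`. Why it might be false: proper irreducible mod-3 images could decay slower in `H` than the family
(STRUCTURE §2 C3-EXH). -/
@[conjecture] def C3EXH_uniform : Prop :=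
  ∀ H : ℕ, 3 ≤ H → (100 : ℚ) * (remSet M H).ncard ≤ 15 * (ntSet M H).ncard

/-- **LEMMA-CANDIDATE LEM1 (PREDICTIONS-17 §3) — a lattice-point statement, model-free; NOT PROVED here.** The principal
class grows like `H³ log H`: there are `0 < c₁ ≤ c₂` and `H₀` with `c₁·H³·log H ≤ W₁₁(H) ≤ c₂·H³·log H` for all `H ≥ H₀`.
Rung 17 (kit j190287…j190353, registered `2cb0780c…`) measures `W₁₁(H)/(H³ log H)` for `H ≤ 16` (report item P104). -/
@[conjecture] def LEM1_principal_class_growth : Prop :=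
  ∃ c₁ c₂ : ℝ, 0 < c₁ ∧ c₁ ≤ c₂ ∧ ∃ H₀ : ℕ, ∀ H : ℕ, H₀ ≤ H →
    c₁ * (H : ℝ) ^ 3 * Real.log H ≤ (w11Count H : ℝ) ∧ (w11Count H : ℝ) ≤ c₂ * (H : ℝ) ^ 3 * Real.log H

end Summit.Ventures.ResidMod.Conjectures
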